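import Summits.CriticalPhenomena.PercolationContinuityZ3.Theorems.PercNearOneGluingNoHeavyLowerTailCoSunflowerGlueRows
import Summits.CriticalPhenomena.PercolationContinuityZ3.Theorems.PercNearOneGluingNoHeavyLowerTailTIncSwitching
import HarnessLib

/-!
# `NoHeavyLowerTail` (stmt-CriticalPhenomena-4575) — COROLLARIES of the `T_inc` theorem: the four-point class `β` and the five-terminal
# E3GRP row `r5` hold on EVERY finite weighted graph

Support file (prover prim-e3grp-switch-3; `--supports stmt-CriticalPhenomena-4575`).  No definitions, no named facts, no sorries.

prim-e3grp-switch-1 proved `TIncRow` (`TIncSwitching.tIncRow_holds`, five-switching certificate I5, p204866):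
`0 ≤ E₃({a↔b}∪{a↔c}, {a↔b}∪{b↔c}, {a↔c}∪{b↔c})` for every finite weighted graph.  Combined with the gluing reductions of
`…CoSunflowerGlue` / `…CoSunflowerGlueRows` (a weight-one pair = the image of `prodBernoulli` under `insert`), this file records the
unconditional consequences:
* `betaRow_holds : BetaRow` — class `β = E₃(U[a|bcy], U[ab|cy], U[acy|b]) ≥ 0` for every finite weighted graph and all `a b c y`
  (`= T_inc` on the graph with `{c,y}` glued);  `row4Holds_five_all` — the same in the `Row4Holds 5` vocabulary of `…E3FourPointClassesLeFive`;
* `rowHolds_five_all` — the five-terminal E3GRP row **`r5 = E₃(U[ob|a₁a₂a₃], U[oa₁a₂b|a₃], U[oa₃b|a₁a₂]) ≥ 0`** (`RowHolds 5`) for every `n`, every weight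
  vector and every terminal tuple (`= T_inc(o,a₃,a₁)` with `{o,b}` and `{a₁,a₂}` glued).
(Class `β` also has an independent four-copy switching certificate, prim-ineq-prove-3 THEOREM-ALPHA-BETA-4COPY.md, Lean pending.)  After this file the open
increasing E3GRP rows of `…E3GroupSepLeFive` are `r4 = γ`, `r6` (both ⟸ `GammaRow`, `…CoSunflowerGlueRows`), `r7`, `r8`.
-/

noncomputable section

namespace Summit.CriticalPhenomena.PercolationContinuityZ3.Theorems

open CoSunflowerGlue CovTransferCert E3GroupSepCert

/-- **Class `β` holds on every finite weighted graph**: `0 ≤ E₃(U[a|bcy], U[ab|cy], U[acy|b])` for all `V`, `w`, `a b c y`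
(`T_inc` theorem of prim-e3grp-switch-1 + gluing `{c,y}`). [this work] -/
theorem betaRow_holds : BetaRow := betaRow_of_tIncRow TIncSwitching.tIncRow_holds

namespace CoSunflowerGlue

variable {n : ℕ}

/-- **Class `β` (`Row4Holds 5`) for every `n`, weight and terminals.** [this work] -/
theorem row4Holds_five_all (w : Sym2 (Fin n) → unitInterval) (a b c y : Fin n) : Row4Holds 5 w (a, b, c, y) :=
  row4Holds_five_of_tIncRow TIncSwitching.tIncRow_holds w a b c y

/-- **The E3GRP row `r5` holds for every `n`, every weight vector and every terminal tuple**: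
`E₃(U[ob|a₁a₂a₃], U[oa₁a₂b|a₃], U[oa₃b|a₁a₂]) ≥ 0`. [this work] -/
theorem rowHolds_five_all (w : Sym2 (Fin n) → unitInterval) (t : Tup n) : RowHolds 5 w t :=
  rowHolds_five_of_tIncRow TIncSwitching.tIncRow_holds w t

end CoSunflowerGlue

end Summit.CriticalPhenomena.PercolationContinuityZ3.Theorems

end
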